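import Literature.Computability.Complexity.OccurrenceObstructionsIPProofs
import Literature.Computability.AlgebraicComplexity.OrbitCoordinateRingProofs
import HarnessLib

/-!
# `ValuativeGCT.ValuativeFlip` (stmt-ValiantsHypothesis-12624): the registered siege stub
# `stub_twistedInheritance` — size-transfer axis, part IV

Crux `ValuativeFlip` of route `ValuativeGCT`; wall-breaker k12/16 (axis "representation-stability
transfer between `m` and `m + 1`", 2026-08-16), proving the two intermediate statements registered on
the crux by the siege plan (`Cruxes/ValuativeFlip/SiegeStubs.lean`, `DECOMPOSITIONS.md`): the second,
`stub_twistedInheritance`, by name and signature, over the first, `stub_evalRankLowerBound` (the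
per-side ENGINE — a nonsingular evaluation matrix of highest-weight vectors at `End`-orbit points is a
multiplicity lower bound — landed by siege seat k3, `ValuativeGCTValuativeFlipEvalRankLowerBoundK3`; a
private copy `ti_evalRank_le_orbitMultiplicity` keeps this file inside the built library):

* `stub_twistedInheritance` — the per-side TRANSPORT along the padding `n ↦ n + j` (the provable,
  twisted half of BLMW 2011 Problem 6.10): a Δ_j-twisted nonsingular evaluation matrix of inner
  highest-weight vectors of weight `μ*` at points `A_l · per_n` gives
  `D ≤ mult_{(μ♯(n+j))*} ℂ[Δ_{n+j}(X₀₀^j per_n)]`.  Lift `F_i ↦ liftHWV n j F_i`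
  (`liftHWV_mem_highestWeightSpace`); the padded points `X_top^j · (A_l · per_n)|segment` ARE
  endomorphism-orbit points `Ã_l · (X₀₀^j per_n)` of the route's padded permanent
  (`exists_linSubst_paddedPerFormLex_eq_paddedForm`: `X₀₀ ↦ X_top`, block ↦ segment through `A_l`),
  and by `aeval_formCoeff_paddedForm_liftHWV` the evaluation matrix of the lifts at these points IS the
  twisted inner matrix; conclude by the engine;
* `exists_linSubst_paddedPerFormLex_eq_paddedForm` — the geometric input, for every padding `j ≥ 0`.

This is where the size-transfer axis has teeth on the per side: abstract padding monotonicity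
`P_n(μ) ≤ mult_pp(μ♯)` stays open (the twist, `…PaddingLift.lean`), but CERTIFICATES transport
exactly, with a twist computable at inner size `n`, for every padding `j` at once.

Sources: Mulmuley–Sohoni 2001 §4–5; BLMW 2011 §5.2, §6.4 (Problem 6.10); Ikenmeyer–Panova 2017
Prop. 2.6(b); Bürgisser–Ikenmeyer–Panova 2019 Lemma 5.2–5.3, Thm. 5.4; Ikenmeyer–Kandasamy 2020 §3.
-/

set_option linter.dupNamespace false

namespace Summit.ValiantsHypothesis.ValiantsHypothesis.Theorems.ValuativeFlip

open scoped BigOperators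
open MvPolynomial
open Literature.NumberTheory.DiophantineGeometry
open Literature.Computability.AlgebraicComplexity
open Literature.Computability.Complexity

noncomputable section

/-! ## The engine (private copy of the landed `stub_evalRankLowerBound`, siege seat k3) -/

/-- A polynomial of the vanishing ideal of `GL · f` vanishes at EVERY endomorphism-orbit point
`A · f`, invertible or not (`I(GL · f) = ker(genericOrbitMap)`, Zariski density of `GL` in `Mat`).
[Mulmuley–Sohoni 2001 §4; folklore] -/
private theorem ti_aeval_formCoeff_linSubst_eq_zero {σ : Type*} [Fintype σ]
    [LinearOrder σ] {f : MvPolynomial σ ℂ} {m : ℕ} {G : MvPolynomial (DegIdx σ m) ℂ}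
    (hG : G ∈ orbitVanishingIdeal f m) (A : Matrix σ σ ℂ) :
    aeval (formCoeff m (linSubst σ ℂ A f)) G = 0 := by
  rw [orbitVanishingIdeal_eq_ker_genericOrbitMap, RingHom.mem_ker] at hG
  have hG' : genericOrbitMap f m G = 0 := hG
  rw [← eval_genericOrbitMap f m G A, hG', map_zero]

/-- The class of a highest-weight vector of `ℂ[Sym^m ℂ^σ]` is a highest-weight vector of
`ℂ[Δ_m(f)]` of the same weight (the quotient map is `GL`-equivariant). [folklore] -/
private theorem ti_mk_mem_highestWeightSpace {σ : Type*} [Fintype σ] [LinearOrder σ]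
    (f : MvPolynomial σ ℂ) (m : ℕ) {χ : Weight σ} {F : MvPolynomial (DegIdx σ m) ℂ}
    (hF : F ∈ highestWeightSpace (coordRep σ ℂ m) χ) :
    (Ideal.Quotient.mk (orbitVanishingIdeal f m) F : OrbitCoordRing f m) ∈
      highestWeightSpace (orbitCoordRep f m) χ := by
  intro g hg
  rw [orbitCoordRep_apply, orbitCoordSubst_mk, ← coordRep_apply, hF g hg]
  rw [← Ideal.Quotient.mkₐ_eq_mk ℂ, map_smul]

/-- **The evaluation-certificate engine** (private copy of the registered stub
`stub_evalRankLowerBound`, landed by siege seat k3 as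
`ValuativeGCTValuativeFlipEvalRankLowerBoundK3.stub_evalRankLowerBound`; copied privately to keep this
file's imports inside the built library).  Highest-weight vectors `F₁ … F_D ∈ ℂ[Sym^m ℂ^σ]` of weight
`χ` with a nonsingular evaluation matrix `(F_i(A_l · f))_{i,l}` at endomorphism-orbit points certify
`D ≤ mult_χ ℂ[Δ_m(f)]` (`m ≠ 0`): their classes are linearly independent highest-weight vectors of
`ℂ[Δ_m(f)]` — a vanishing combination lies in `I(GL · f)`, vanishes at every `A_l · f`, and is killed
by the nonsingular matrix (`Matrix.eq_zero_of_vecMul_eq_zero`).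
[Mulmuley–Sohoni 2001 §4–5; BLMW 2011 §5.2; Ikenmeyer–Kandasamy 2020 §3] -/
private theorem ti_evalRank_le_orbitMultiplicity {σ : Type} [Fintype σ] [LinearOrder σ]
    (f : MvPolynomial σ ℂ) (m : ℕ) (hm : m ≠ 0) (χ : Weight σ) (D : ℕ)
    (F : Fin D → MvPolynomial (DegIdx σ m) ℂ) (hF : ∀ i, F i ∈ highestWeightSpace (coordRep σ ℂ m) χ)
    (A : Fin D → Matrix σ σ ℂ)
    (hdet : (Matrix.of fun i l : Fin D =>
      MvPolynomial.aeval (formCoeff m (linSubst σ ℂ (A l) f)) (F i)).det ≠ 0) :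
    D ≤ orbitMultiplicity ℂ f m χ := by
  classical
  haveI : FiniteDimensional ℂ (highestWeightSpace (orbitCoordRep f m) χ) :=
    finiteDimensional_highestWeightSpace_orbitCoordRep_holds (k := ℂ) f hm χ
  -- the classes, as highest-weight vectors of `ℂ[Δ_m(f)]`
  let v : Fin D → highestWeightSpace (orbitCoordRep f m) χ := fun i =>
    ⟨Ideal.Quotient.mk (orbitVanishingIdeal f m) (F i), ti_mk_mem_highestWeightSpace f m (hF i)⟩
  have hli : LinearIndependent ℂ v := by
    rw [Fintype.linearIndependent_iff]
    intro c hc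
    -- the combination lies in the ideal
    have hmem : ∑ i, c i • F i ∈ orbitVanishingIdeal f m := by
      rw [← Ideal.Quotient.eq_zero_iff_mem, map_sum]
      have h := congrArg Subtype.val hc
      rw [Submodule.coe_sum, Submodule.coe_zero] at h
      have hsm : ∀ i, Ideal.Quotient.mk (orbitVanishingIdeal f m) (c i • F i) =
          c i • Ideal.Quotient.mk (orbitVanishingIdeal f m) (F i) := fun i => by
        rw [← Ideal.Quotient.mkₐ_eq_mk ℂ, map_smul]
      simp only [hsm]
      simpa [v] using h
    -- hence vanishes at every `A l · f`: `c ᵥ* M = 0`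
    have hvec : Matrix.vecMul c
        (Matrix.of fun i l : Fin D => MvPolynomial.aeval (formCoeff m (linSubst σ ℂ (A l) f)) (F i)) = 0 := by
      funext l
      have h := ti_aeval_formCoeff_linSubst_eq_zero hmem (A l)
      rw [map_sum] at h
      simp only [map_smul, smul_eq_mul] at h
      rw [Matrix.vecMul, dotProduct]
      simpa [Matrix.of_apply] using h
    exact congrFun (Matrix.eq_zero_of_vecMul_eq_zero hdet hvec)
  have h := hli.fintype_card_le_finrank
  rw [Fintype.card_fin] at h
  exact h

/-! ## The padded inner points are endomorphism-orbit points of the route's padded permanent -/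

/-- The padded permanent along an enumeration of its block: `X₀₀^{m-n} · per_n(X_E)`,
`E ab = toLex (e a, e b)` (k4's `frt_paddedPerFormLex_eq`, restated to keep this file's imports
free of the route file). [folklore] -/
theorem ti_paddedPerFormLex_eq (n m : ℕ) [NeZero m] (e : Fin n ≃ BlockIdx n m) :
    paddedPerFormLex ℂ n m = (X (toLex ((0 : Fin m), (0 : Fin m))) : MvPolynomial (MatIdx m) ℂ) ^ (m - n) *
      rename (fun ab : Fin n × Fin n => (toLex (((e ab.1 : BlockIdx n m) : Fin m), ((e ab.2 : BlockIdx n m) : Fin m)) : MatIdx m))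
        (perPoly (Fin n) ℂ) := by
  rw [paddedPerFormLex_eq, ← rename_perPoly_equiv (k := ℂ) e, rename_rename]
  rfl

/-- A linear substitution on a renamed polynomial is the evaluation at the images of the renamed
variables. [folklore] -/
theorem linSubst_rename_eq_aeval {α τ : Type*} [Fintype τ] [DecidableEq τ] (M : Matrix τ τ ℂ)
    (κ : α → τ) (P : MvPolynomial α ℂ) :
    linSubst τ ℂ M (rename κ P) = aeval (fun a => linSubst τ ℂ M (X (κ a))) P := by
  suffices H : (linSubst τ ℂ M).comp (rename κ) = aeval (fun a => linSubst τ ℂ M (X (κ a))) from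
    congrArg (fun φ => φ P) H
  exact MvPolynomial.algHom_ext fun a => by simp only [AlgHom.comp_apply, rename_X, aeval_X]

/-- Renaming an evaluation is evaluating at the renamed images. [folklore] -/
theorem rename_aeval_eq_aeval {α τ τ' : Type*} (ι : τ → τ') (G : α → MvPolynomial τ ℂ)
    (P : MvPolynomial α ℂ) :
    rename ι (aeval G P) = aeval (fun a => rename ι (G a)) P := by
  suffices H : (rename ι).comp (aeval G) = aeval (fun a => rename ι (G a)) from
    congrArg (fun φ => φ P) H
  exact MvPolynomial.algHom_ext fun a => by simp

/-- **The padded inner points are `End`-orbit points of the padded permanent.**  For every matrix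
`A ∈ Mat_{n²}` there is `Ã ∈ Mat_{(n+j)²}` with
`Ã · (X₀₀^j per_n) = X_top^j · (A · per_n)|segment` (`paddedForm n j (A · per_n)`): send the padding
variable `X₀₀` to the top variable and each block variable to the segment copy of the corresponding
column of `A` (for `j = 0` the padding power is `1` and the block is everything).
[Mulmuley–Sohoni 2001 §4; Bürgisser–Ikenmeyer–Panova 2019 §1(a)] -/
theorem exists_linSubst_paddedPerFormLex_eq_paddedForm (n j : ℕ) [NeZero n] [NeZero (n + j)]
    (A : Matrix (MatIdx n) (MatIdx n) ℂ) :
    ∃ M : Matrix (MatIdx (n + j)) (MatIdx (n + j)) ℂ,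
      linSubst (MatIdx (n + j)) ℂ M (paddedPerFormLex ℂ n (n + j)) =
        paddedForm n j (linSubst (MatIdx n) ℂ A (paddedPerFormLex ℂ n n)) := by
  classical
  -- enumerations of the two blocks
  let e₁ : Fin n ≃ BlockIdx n (n + j) :=
    (Fintype.equivFinOfCardEq (card_blockIdx (Nat.le_add_right n j))).symm
  let e₀ : Fin n ≃ BlockIdx n n := (Fintype.equivFinOfCardEq (card_blockIdx le_rfl)).symm
  -- block variables at level `n + j` are never the padding variable when `0 < j`, and are
  -- enumerated injectively
  have hinj : Function.Injective fun ab : Fin n × Fin n =>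
      (toLex (((e₁ ab.1 : BlockIdx n (n + j)) : Fin (n + j)), ((e₁ ab.2 : BlockIdx n (n + j)) : Fin (n + j))) : MatIdx (n + j)) := by
    intro ab ab' h
    have h1 := congrArg (fun x : MatIdx (n + j) => (ofLex x).1) h
    have h2 := congrArg (fun x : MatIdx (n + j) => (ofLex x).2) h
    simp only [ofLex_toLex] at h1 h2
    exact Prod.ext (e₁.injective (Subtype.ext h1)) (e₁.injective (Subtype.ext h2))
  -- the substitution matrix, column by column
  let M : Matrix (MatIdx (n + j)) (MatIdx (n + j)) ℂ := fun s i =>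
    if h : ∃ ab : Fin n × Fin n,
        (toLex (((e₁ ab.1 : BlockIdx n (n + j)) : Fin (n + j)), ((e₁ ab.2 : BlockIdx n (n + j)) : Fin (n + j))) : MatIdx (n + j)) = i then
      ∑ r : MatIdx n, (if segEmb (Nat.le_add_right n j) r = s then
        A r (toLex (((e₀ (Classical.choose h).1 : BlockIdx n n) : Fin n), ((e₀ (Classical.choose h).2 : BlockIdx n n) : Fin n))) else 0)
    else if i = toLex ((0 : Fin (n + j)), (0 : Fin (n + j))) then (if s = topMatIdx (n + j) then 1 else 0) else 0
  have hM_block : ∀ ab : Fin n × Fin n,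
      linSubst (MatIdx (n + j)) ℂ M
          (X (toLex (((e₁ ab.1 : BlockIdx n (n + j)) : Fin (n + j)), ((e₁ ab.2 : BlockIdx n (n + j)) : Fin (n + j))))) =
        ∑ r : MatIdx n, A r (toLex (((e₀ ab.1 : BlockIdx n n) : Fin n), ((e₀ ab.2 : BlockIdx n n) : Fin n))) •
          (X (segEmb (Nat.le_add_right n j) r) : MvPolynomial (MatIdx (n + j)) ℂ) := by
    intro ab
    have hex : ∃ ab' : Fin n × Fin n,
        (toLex (((e₁ ab'.1 : BlockIdx n (n + j)) : Fin (n + j)), ((e₁ ab'.2 : BlockIdx n (n + j)) : Fin (n + j))) : MatIdx (n + j)) =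
          toLex (((e₁ ab.1 : BlockIdx n (n + j)) : Fin (n + j)), ((e₁ ab.2 : BlockIdx n (n + j)) : Fin (n + j))) :=
      ⟨ab, rfl⟩
    have hch : Classical.choose hex = ab := hinj (Classical.choose_spec hex)
    rw [linSubst_X]
    simp only [M, dif_pos hex, hch, Finset.sum_smul, ite_smul, zero_smul]
    rw [Finset.sum_comm]
    refine Finset.sum_congr rfl fun r _ => ?_
    rw [Finset.sum_ite_eq Finset.univ (segEmb (Nat.le_add_right n j) r), if_pos (Finset.mem_univ _)]
  have hM_pad : 0 < j → linSubst (MatIdx (n + j)) ℂ M (X (toLex ((0 : Fin (n + j)), (0 : Fin (n + j))))) =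
      X (topMatIdx (n + j)) := by
    intro hj
    have hnot : ¬ ∃ ab : Fin n × Fin n,
        (toLex (((e₁ ab.1 : BlockIdx n (n + j)) : Fin (n + j)), ((e₁ ab.2 : BlockIdx n (n + j)) : Fin (n + j))) : MatIdx (n + j)) =
          toLex ((0 : Fin (n + j)), (0 : Fin (n + j))) := by
      rintro ⟨ab, hab⟩
      have h1 := congrArg (fun x : MatIdx (n + j) => (((ofLex x).1 : Fin (n + j)) : ℕ)) hab
      simp only [ofLex_toLex, Fin.val_zero] at h1
      have h2 := (e₁ ab.1).2
      omega
    rw [linSubst_X]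
    simp only [M, dif_neg hnot, if_true, ite_smul, one_smul, zero_smul]
    rw [Finset.sum_ite_eq' Finset.univ (topMatIdx (n + j)), if_pos (Finset.mem_univ _)]
  refine ⟨M, ?_⟩
  -- unfold both padded permanents along the enumerations
  have hpow₁ : (X (toLex ((0 : Fin (n + j)), (0 : Fin (n + j)))) : MvPolynomial (MatIdx (n + j)) ℂ) ^ (n + j - n) =
      X (toLex ((0 : Fin (n + j)), (0 : Fin (n + j)))) ^ j := by
    rw [Nat.add_sub_cancel_left]
  have hpow₀ : (X (toLex ((0 : Fin n), (0 : Fin n))) : MvPolynomial (MatIdx n) ℂ) ^ (n - n) = 1 := by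
    rw [Nat.sub_self, pow_zero]
  rw [ti_paddedPerFormLex_eq n (n + j) e₁, ti_paddedPerFormLex_eq n n e₀, hpow₁, hpow₀, one_mul, map_mul,
    map_pow, paddedForm, linSubst_rename_eq_aeval, linSubst_rename_eq_aeval, rename_aeval_eq_aeval]
  have himg : (fun ab : Fin n × Fin n => linSubst (MatIdx (n + j)) ℂ M
        (X (toLex (((e₁ ab.1 : BlockIdx n (n + j)) : Fin (n + j)), ((e₁ ab.2 : BlockIdx n (n + j)) : Fin (n + j)))))) =
      fun ab => rename (segEmb (Nat.le_add_right n j))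
        (linSubst (MatIdx n) ℂ A (X (toLex (((e₀ ab.1 : BlockIdx n n) : Fin n), ((e₀ ab.2 : BlockIdx n n) : Fin n))))) := by
    funext ab
    rw [hM_block, linSubst_X, map_sum]
    simp only [map_smul, rename_X]
  rw [himg]
  congr 1
  rcases Nat.eq_zero_or_pos j with hj | hj
  · subst hj
    simp
  · rw [hM_pad hj]

/-! ## Twisted inheritance -/

/-- **stub_twistedInheritance** (registered siege stub, verbatim).  For inner size `n`, padding `j`,
degree `δ`, an inner shape `μ ⊢ nδ` with `≤ n²` parts, highest-weight vectors `F₁ … F_D` of weight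
`μ*` on `ℂ[Sym^n ℂ^{n²}]` and matrices `A₁ … A_D ∈ Mat_{n²}`: if the Δ_j-TWISTED evaluation matrix
`(F_i(Δ_j(A_l · per_n)))_{i,l}` is nonsingular (`Δ_j` rescales the coefficient of `x^e` by
`(e_top + j)!/e_top!`), then `D ≤ mult_{(μ♯(n+j))*} ℂ[Δ_{n+j}(X₀₀^j per_n)]`.  The lifts
`liftHWV n j F_i` are highest-weight vectors of weight `(μ♯)*` (`liftHWV_mem_highestWeightSpace`),
the padded inner points are `End`-orbit points `Ã_l · (X₀₀^j per_n)`
(`exists_linSubst_paddedPerFormLex_eq_paddedForm`), the evaluation matrix of the lifts there is the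
twisted inner matrix (`aeval_formCoeff_paddedForm_liftHWV`), and the evaluation-certificate engine
(`stub_evalRankLowerBound`, here the private copy `ti_evalRank_le_orbitMultiplicity`) concludes.
[Ikenmeyer–Panova 2017 Prop. 2.6(b); Bürgisser–Ikenmeyer–Panova 2019 Lemma 5.2, Thm. 5.4;
BLMW 2011 §6.4 Problem 6.10] -/
theorem stub_twistedInheritance :
    ∀ (n j δ : ℕ) [NeZero n] [NeZero (n + j)] (μ : Nat.Partition (n * δ)), μ.parts.card ≤ n * n →
      ∀ (D : ℕ) (F : Fin D → MvPolynomial (DegIdx (MatIdx n) n) ℂ),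
        (∀ i, F i ∈ highestWeightSpace (coordRep (MatIdx n) ℂ n) (partitionWeightLex n μ)) →
        ∀ (A : Fin D → Matrix (MatIdx n) (MatIdx n) ℂ),
          (Matrix.of fun i l : Fin D => MvPolynomial.aeval
              (fun e : DegIdx (MatIdx n) n =>
                (((e.1 (topMatIdx n) + j).descFactorial j : ℕ) : ℂ) *
                  MvPolynomial.coeff e.1 (linSubst (MatIdx n) ℂ (A l) (paddedPerFormLex ℂ n n)))
              (F i)).det ≠ 0 →
          D ≤ orbitMultiplicity ℂ (paddedPerFormLex ℂ n (n + j)) (n + j) (partitionWeightLex (n + j) (rowLift μ j)) := by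
  intro n j δ _ _ μ hμ D F hF A hdet
  classical
  -- the padded points as `End`-orbit points
  choose M hM using fun l : Fin D => exists_linSubst_paddedPerFormLex_eq_paddedForm n j (A l)
  have hhom : ∀ l, (linSubst (MatIdx n) ℂ (A l) (paddedPerFormLex ℂ n n)).IsHomogeneous n := fun l =>
    linSubst_isHomogeneous _ (paddedPerFormLex_isHomogeneous ℂ le_rfl)
  refine ti_evalRank_le_orbitMultiplicity (paddedPerFormLex ℂ n (n + j)) (n + j) (NeZero.ne (n + j))
    (partitionWeightLex (n + j) (rowLift μ j)) D (fun i => liftHWV n j (F i))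
    (fun i => liftHWV_mem_highestWeightSpace μ hμ j (hF i)) M ?_
  have hmat : (Matrix.of fun i l : Fin D => MvPolynomial.aeval
        (formCoeff (n + j) (linSubst (MatIdx (n + j)) ℂ (M l) (paddedPerFormLex ℂ n (n + j)))) (liftHWV n j (F i))) =
      Matrix.of fun i l : Fin D => MvPolynomial.aeval
        (fun e : DegIdx (MatIdx n) n =>
          (((e.1 (topMatIdx n) + j).descFactorial j : ℕ) : ℂ) *
            MvPolynomial.coeff e.1 (linSubst (MatIdx n) ℂ (A l) (paddedPerFormLex ℂ n n))) (F i) := by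
    ext i l
    rw [Matrix.of_apply, Matrix.of_apply, hM l, aeval_formCoeff_paddedForm_liftHWV j (hhom l)]
  rw [hmat]
  exact hdet

end

end Summit.ValiantsHypothesis.ValiantsHypothesis.Theorems.ValuativeFlip
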